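import Literature.AlgebraicGeometry.Resolution.RationalSurfaceSingularitiesBasic
import Literature.AlgebraicGeometry.Resolution.ProjectiveSpaceRegular
import Literature.AlgebraicGeometry.Resolution.AdicCompletionRegular
import Literature.AlgebraicGeometry.Resolution.AffineBlowup
import Literature.AlgebraicGeometry.Morphisms.CechH1AffineProofs
import Summits.ResolutionOfSingularities.ResolutionOfSingularities.Theorems.HomologicalConductorNoZenoCaPrincipalReductions
import Summits.ResolutionOfSingularities.ResolutionOfSingularities.Theorems.HomologicalConductorNoZenoRegularOfBasePtsEmpty
import HarnessLib

/-!
# Crux `NoZenoR` (stmt-ResolutionOfSingularities-19943) = `NoZeno` (stmt-16483), line `sandwich-cluster`,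
# S3 G-layer row G0a: a singular sandwiched stage `T_m` has a RATIONAL singularity, hence (GE) a
# minimal resolution — modulo Lipman's named facts (1.2), (4.1)

OURS (cell res-hironaka, chain W4.4; stub worker res-L0-w44-stub-3; lead res-L0-w44-lead-1 KERNEL-L0 §16
R6 «G0», skeleton v15 registered stub `stub_minResolutionExists` = GE). The G-layer of THEOREM Q-rat
(res-L0-w44-idea-1; CRUX-PLAN v6 §B) works on a minimal resolution `π : X ⟶ Spec T_m` of the singular
late stage `T_m = tower O A m` (`m ≥ m₀ + 1`) and consumes `H¹(X, 𝒪_X) = 0`. Both come from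
«`T_m` has a rational singularity» (stub-4's `RationalSurfaceSingularitiesBasic`:
`Lipman1969_1_2.hasTrivialCechH1_of_isResolution`, `Lipman1969_4_1.exists_isMinimalResolution_Spec`).
This file proves that input:

* `hasTrivialCechH1_of_isAffine`, `hasRationalSingularity_of_isRegularLocalRing` — an affine scheme
  has `Ȟ¹(𝒰, 𝒪) = 0` (tree: `cechH1_affine_vanishing_holds`), so a regular local ring has a rational
  singularity through the identity desingularization (Lipman, Def. (1.1));
* `isLocalizationAway_of_denominator`, `isBirational_specMap_of_denominator` — for domains
  `R ⊆ B` with `B` finitely generated over `R` inside `Frac R` (a common denominator `r`: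
  `rⁿ b ∈ R` for all `b ∈ B`), `Spec B → Spec R` is birational (an isomorphism over `D(r)`);
* `hasRationalSingularity_of_isLocalization` — Lipman's Prop. (1.2) (1) in ring form: a normal
  two-dimensional localisation of such a `B` at a prime has a rational singularity;
* `hasRationalSingularity_tower` (**G0a**) — for `ctx : SandwichCtx O A R m₀`, `m ≥ m₀ + 1` and
  `T_m` singular: `HasRationalSingularity ↥(tower O A m)` (the regular `R ≤ T_m` is rational;
  `T_m` is the local ring of the affine sandwich model `Spec B₀ → Spec R`,
  `B₀ = EssFiniteType.subalgebra R T_m`);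
* `hasTrivialCechH1_of_isResolution_tower`, `minResolutionExists_of_lipman` — the two G-layer
  binders: every resolution of `Spec T_m` has `H¹(X, 𝒪_X) = 0`, and (the registered stub GE
  `stub_minResolutionExists` in CONDITIONAL form) `Spec T_m` has a minimal resolution.

Everything is conditional on the named facts `Lipman1969_1_2` / `Lipman1969_4_1` (p498126) exactly as
the G-layer carries them; nothing of [claim: Hironaka2017] is used. AI-written; weaker than expert
review.

References: J. Lipman, Publ. Math. IHÉS 36 (1969), Def. (1.1), Prop. (1.2), Thm. (4.1) [`Lipman1969`];
The Stacks Project, Tags 01XD, 01RN [`StacksProject`].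
-/

-- single-problem summit: the doubled namespace component `ResolutionOfSingularities` is forced
set_option linter.dupNamespace false

noncomputable section

namespace Summit.ResolutionOfSingularities.ResolutionOfSingularities.Theorems.NoZeno.SandwichCluster

open CategoryTheory AlgebraicGeometry TopologicalSpace IsLocalRing
open Literature.AlgebraicGeometry.Resolution Literature.AlgebraicGeometry.Morphisms
open Literature.RingTheory.CohomologyAnnihilator
open Summit.ResolutionOfSingularities.ResolutionOfSingularities.Theorems.NoZeno.Birth

universe u

/-! ## `H¹ = 0` on affine schemes; regular local rings are rational -/

/-- An affine scheme `X → Spec A` has `Ȟ¹(𝒰, 𝒪_X) = 0` for every finite affine open cover `𝒰`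
(indeed for every open cover: the tree's `cechH1_affine_vanishing_holds`).
[cite: StacksProject, Tag 01XD] -/
theorem hasTrivialCechH1_of_isAffine {A : Type u} [CommRing A] {X : Scheme.{u}} [IsAffine X]
    (f : X ⟶ Spec (.of A)) : HasTrivialCechH1 f := by
  intro ι _ U _ hU
  rw [Submodule.Quotient.subsingleton_iff, eq_top_iff]
  rintro z -
  exact cechH1_affine_vanishing_holds f (isAffineOpen_top X) U hU z.2

/-- **A regular local ring has a rational singularity** (Lipman, Def. (1.1): «if `R` is regular
then `R` has a rational singularity» — the identity of `Spec R` is a desingularization, `Spec R`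
being regular by Serre's theorem on localisations, and `H¹` of an affine scheme vanishes).
[cite: Lipman1969, Definition (1.1) (p. 199)] -/
theorem hasRationalSingularity_of_isRegularLocalRing (R : Type u) [CommRing R]
    [IsRegularLocalRing R] : HasRationalSingularity R := by
  haveI : IsRegularRing (CommRingCat.of R) := isRegularRing_of_isRegularLocalRing R
  refine ⟨Spec (.of R), 𝟙 _, ⟨inferInstance, ⟨⊤, by simp, by simp, inferInstance⟩,
    Scheme.isRegular_Spec (.of R)⟩, hasTrivialCechH1_of_isAffine _⟩

/-! ## Birational affine models: a finitely generated subring of the fraction field -/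

section Denominator

variable {R B : Type u} [CommRing R] [CommRing B] [IsDomain B] [Algebra R B]

/-- **Common denominator ⇒ localisation.** If `R → B` is injective into a domain, `r ≠ 0`, and
every `b ∈ B` satisfies `rⁿ b ∈ R` for some `n` (a common denominator `r ∈ R`, e.g. `B` finitely
generated over `R` inside `Frac R`), then `B[1/r]` is the localisation `R[1/r]` of `R`. [folklore] -/
theorem isLocalizationAway_of_denominator (hinj : Function.Injective (algebraMap R B)) (r : R)
    (hr : r ≠ 0) (hB : ∀ b : B, ∃ n : ℕ, ∃ a : R, algebraMap R B a = algebraMap R B r ^ n * b) :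
    IsLocalization.Away r (Localization.Away (algebraMap R B r)) := by
  set φ := algebraMap R B with hφ
  set S := Localization.Away (φ r)
  have hφr : φ r ≠ 0 := fun h => hr (hinj (by rw [h, map_zero]))
  have hRS : algebraMap R S = (algebraMap B S).comp φ := IsScalarTower.algebraMap_eq R B S
  have hinjS : Function.Injective (algebraMap B S) :=
    IsLocalization.injective S (powers_le_nonZeroDivisors_of_noZeroDivisors hφr)
  refine ⟨?_, ?_, ?_⟩
  · rintro ⟨_, n, rfl⟩
    rw [hRS, RingHom.comp_apply, map_pow, map_pow]
    exact (IsLocalization.Away.algebraMap_isUnit (φ r)).pow n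
  · intro z
    obtain ⟨⟨b, s⟩, hz⟩ := IsLocalization.surj (Submonoid.powers (φ r)) z
    obtain ⟨m, hm⟩ := s.2
    obtain ⟨n, a, ha⟩ := hB b
    refine ⟨(a, ⟨r ^ (n + m), n + m, rfl⟩), ?_⟩
    change z * algebraMap R S (r ^ (n + m)) = algebraMap R S a
    rw [hRS, RingHom.comp_apply, RingHom.comp_apply, ha, map_pow, map_pow, map_mul, map_pow,
      pow_add]
    have hm' : φ r ^ m = (s : B) := hm
    have hz' : z * algebraMap B S (φ r) ^ m = algebraMap B S b := by
      rw [← map_pow, hm']; exact hz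
    calc z * (algebraMap B S (φ r) ^ n * algebraMap B S (φ r) ^ m)
        = (z * algebraMap B S (φ r) ^ m) * algebraMap B S (φ r) ^ n := by ring
      _ = algebraMap B S (φ r) ^ n * algebraMap B S b := by rw [hz', mul_comm]
  · intro x y hxy
    refine ⟨1, ?_⟩
    rw [hRS] at hxy
    have := hinj (hinjS hxy)
    simp [this]

/-- **A finitely generated subring of the fraction field gives a birational affine model.** With
`R ⊆ B` domains and a common denominator `r ≠ 0` as above, `Spec B → Spec R` is birational: it is an
isomorphism over the dense open `D(r)`, whose preimage `D(r) ⊆ Spec B` is dense (Stacks 01RN).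
[cite: StacksProject, Tag 01RN] -/
theorem isBirational_specMap_of_denominator [IsDomain R] (hinj : Function.Injective (algebraMap R B))
    (r : R) (hr : r ≠ 0)
    (hB : ∀ b : B, ∃ n : ℕ, ∃ a : R, algebraMap R B a = algebraMap R B r ^ n * b) :
    IsBirational (Spec.map (CommRingCat.ofHom (algebraMap R B))) := by
  set φ := algebraMap R B with hφ
  let S := Localization.Away (φ r)
  haveI : IsLocalization.Away r S := isLocalizationAway_of_denominator hinj r hr hB
  have hφr : φ r ≠ 0 := fun h => hr (hinj (by rw [h, map_zero]))
  let g : Spec (.of B) ⟶ Spec (.of R) := Spec.map (CommRingCat.ofHom φ)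
  let j : Spec (.of S) ⟶ Spec (.of B) := Spec.map (CommRingCat.ofHom (algebraMap B S))
  have hjg : j ≫ g = Spec.map (CommRingCat.ofHom (algebraMap R S)) := by
    change Spec.map _ ≫ Spec.map _ = _
    rw [← Spec.map_comp, ← CommRingCat.ofHom_comp, ← IsScalarTower.algebraMap_eq R B S]
  haveI : IsOpenImmersion j := IsOpenImmersion.of_isLocalization (φ r)
  haveI : IsOpenImmersion (j ≫ g) := by rw [hjg]; exact IsOpenImmersion.of_isLocalization r
  refine ⟨PrimeSpectrum.basicOpen r, dense_basicOpen_of_ne_zero r hr, ?_, ?_⟩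
  · rw [SpecMap_preimage_basicOpen]
    exact dense_basicOpen_of_ne_zero (φ r) hφr
  · refine isIso_morphismRestrict_of_isOpenImmersion g _ j ?_ ?_
    · change Set.range j = ((Spec.map (CommRingCat.ofHom φ) ⁻¹ᵁ PrimeSpectrum.basicOpen r :
        (Spec (.of B)).Opens) : Set (Spec (.of B)))
      rw [SpecMap_preimage_basicOpen]
      exact PrimeSpectrum.localization_away_comap_range S (φ r)
    · rw [hjg]
      exact PrimeSpectrum.localization_away_comap_range S r

end Denominator

/-! ## Lipman (1.2) (1) in ring form -/

/-- **Rational singularities ascend to normal points of birational models of finite type**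
(Lipman, Prop. (1.2) (1), ring form): `R` a two-dimensional normal Noetherian local domain with a
rational singularity, `B ⊇ R` a finitely generated `R`-algebra and a domain with a common
denominator `r ≠ 0` (so `Spec B → Spec R` is birational of finite type), `𝔮` a prime of `B` whose
local ring `T = B_𝔮` is normal of dimension two: then `T` has a rational singularity.
[cite: Lipman1969, Proposition (1.2) 1) (p. 199)] -/
theorem hasRationalSingularity_of_isLocalization (h12 : Lipman1969_1_2.{u}) {R B T : Type u}
    [CommRing R] [IsNoetherianRing R] [IsLocalRing R] [IsDomain R] [IsIntegrallyClosed R]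
    (hdimR : ringKrullDim R = 2) (hR : HasRationalSingularity R)
    [CommRing B] [IsDomain B] [Algebra R B] [Algebra.FiniteType R B]
    (hinj : Function.Injective (algebraMap R B)) (r : R) (hr : r ≠ 0)
    (hB : ∀ b : B, ∃ n : ℕ, ∃ a : R, algebraMap R B a = algebraMap R B r ^ n * b)
    (𝔮 : Ideal B) [𝔮.IsPrime] [CommRing T] [Algebra B T] [IsLocalization.AtPrime T 𝔮]
    [IsIntegrallyClosed T] (hdimT : ringKrullDim T = 2) : HasRationalSingularity T := by
  haveI : IsDomain (CommRingCat.of B) := ‹IsDomain B›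
  let g : Spec (.of B) ⟶ Spec (.of R) := Spec.map (CommRingCat.ofHom (algebraMap R B))
  haveI : LocallyOfFiniteType g := by
    rw [HasRingHomProperty.Spec_iff (P := @LocallyOfFiniteType)]
    exact RingHom.finiteType_algebraMap.mpr ‹Algebra.FiniteType R B›
  have hbir : IsBirational g := isBirational_specMap_of_denominator hinj r hr hB
  obtain ⟨h1, -⟩ := h12 R hdimR hR (Spec (.of B)) g hbir
  let w : Spec (.of B) := ⟨𝔮, ‹𝔮.IsPrime›⟩
  letI : Algebra B ((Spec (.of B)).presheaf.stalk w) := StructureSheaf.stalkAlgebra B w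
  haveI : IsLocalization.AtPrime ((Spec (.of B)).presheaf.stalk w) 𝔮 :=
    StructureSheaf.IsLocalization.to_stalk B w
  let e : (Spec (.of B)).presheaf.stalk w ≃ₐ[B] T := IsLocalization.algEquiv 𝔮.primeCompl _ _
  have hwN : IsIntegrallyClosed ((Spec (.of B)).presheaf.stalk w) :=
    IsIntegrallyClosed.of_equiv e.toRingEquiv.symm
  have hwdim : ringKrullDim ((Spec (.of B)).presheaf.stalk w) = 2 := by
    rw [ringKrullDim_eq_of_ringEquiv e.toRingEquiv]; exact hdimT
  exact (h1 w hwN hwdim).of_ringEquiv e.toRingEquiv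


/-! ## G0a: the singular sandwiched stage has a rational singularity -/

section Tower

variable {k K : Type} [Field k] [Field K] [Algebra k K]

/-- **Local-ring package of a singular late stage.** For `ctx : SandwichCtx O A R m₀`, `m ≥ m₀ + 1`
and `T_m` singular: `T_m` is a Noetherian local normal domain of Krull dimension `2`, an isolated
singularity, with `Frac T_m = K`; and the regular base has `dim R = 2`. (Collected from the tree:
`stub_towerNoetherian`, `exists_tower_eq_loc`, `d2rc_isIntegrallyClosed_tower_succ`,
`d2rc_ringKrullDim_tower_le`, `tower_isIsolatedSingularity`,
`isRegularLocalRing_of_ringKrullDim_base_le_one`.) [folklore] -/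
theorem stage_package (O : ValuationSubring K) (A R : Subalgebra k K) (m₀ : ℕ)
    (ctx : SandwichCtx O A R m₀) (m : ℕ) (hm : m₀ + 1 ≤ m)
    (hsing : ¬ IsRegularLocalRing ↥(tower O A m)) :
    IsNoetherianRing ↥(tower O A m) ∧ IsIntegrallyClosed ↥(tower O A m) ∧
      IsFractionRing ↥(tower O A m) K ∧
      ∃ _ : IsLocalRing ↥(tower O A m),
        ringKrullDim ↥(tower O A m) = 2 ∧ IsIsolatedSingularity ↥(tower O A m) ∧
          ringKrullDim ↥R = 2 := by
  obtain ⟨hk, hA, hfr, hAO, htr, hRreg, hRfr, -, -, hRT⟩ := id ctx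
  obtain ⟨n, rfl⟩ : ∃ n, m = n + 1 := ⟨m - 1, by omega⟩
  haveI := hfr
  haveI := hRfr
  haveI := hRreg
  have hRT' : R ≤ tower O A (n + 1) := hRT (n + 1) (by omega)
  haveI : IsNoetherianRing ↥(tower O A (n + 1)) := stub_towerNoetherian k K O A hk hA hfr hAO _
  haveI : IsLocalRing ↥(tower O A (n + 1)) := by
    obtain ⟨B, hBO, hTB⟩ := exists_tower_eq_loc O A hk hAO (n + 1)
    rw [hTB, loc_eq_locAt]; exact SyzygyFlattening.isLocalRing_locAt O B hBO
  haveI : IsIntegrallyClosed ↥(tower O A (n + 1)) :=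
    d2rc_isIntegrallyClosed_tower_succ O A hk hA hfr hAO n
  have hfrT : IsFractionRing ↥(tower O A (n + 1)) K := isFractionRing_subalgebra_of_le R _ hRT'
  -- `dim R = 2`: a base of dimension `≤ 1` would make the normal stage regular
  have hdimR : ringKrullDim ↥R = 2 := by
    by_contra hne
    apply hsing
    refine isRegularLocalRing_of_ringKrullDim_base_le_one O A hk hA hfr hAO n R hRreg ?_ hRT'
    by_contra h1
    exact hne (ringKrullDim_eq_two_of_not_le_one (ringKrullDim_le_two_of_trdeg htr R) h1)
  -- `dim T = 2`: a normal Noetherian local domain of dimension `≤ 1` is regular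
  have hdimT : ringKrullDim ↥(tower O A (n + 1)) = 2 := by
    refine ringKrullDim_eq_two_of_not_le_one (d2rc_ringKrullDim_tower_le O A (n + 1) htr.le) ?_
    intro h1
    exact hsing (Literature.AlgebraicGeometry.Resolution.isRegularLocalRing_of_isIntegrallyClosed_of_ringKrullDim_le_one _ h1)
  exact ⟨inferInstance, inferInstance, hfrT, inferInstance, hdimT,
    tower_isIsolatedSingularity O A hk hA hfr hAO htr.le n, hdimR⟩

/-- **Common denominators for a finitely generated subalgebra of the fraction field.** If
`Frac R = K` and `s ⊆ T` is finite, `R ≤ T ≤ K`, then some `0 ≠ r ∈ R` clears all denominators: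
`r · x ∈ R` for `x ∈ s`, hence `rⁿ · b ∈ R` for every `b` of the `R`-algebra generated by `s`.
[folklore] -/
theorem exists_denominator_adjoin (R T : Subalgebra k K) (hRT : R ≤ T) [IsFractionRing ↥R K]
    (s : Finset ↥T) :
    letI : Algebra ↥R ↥T := (Subalgebra.inclusion hRT).toRingHom.toAlgebra
    ∃ r : ↥R, r ≠ 0 ∧ ∀ b ∈ Algebra.adjoin ↥R (s : Set ↥T),
      ∃ n : ℕ, ∃ a : ↥R, (a : K) = (r : K) ^ n * (b : K) := by
  letI : Algebra ↥R ↥T := (Subalgebra.inclusion hRT).toRingHom.toAlgebra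
  classical
  -- a denominator for each element of `T`
  have hden : ∀ x : ↥T, ∃ d : ↥R, d ≠ 0 ∧ ∃ a : ↥R, (a : K) = (d : K) * (x : K) := by
    intro x
    obtain ⟨⟨a, d⟩, h⟩ := IsLocalization.surj (nonZeroDivisors ↥R) (x : K)
    refine ⟨d, nonZeroDivisors.ne_zero d.2, a, ?_⟩
    have h' : (x : K) * (d : K) = (a : K) := h
    rw [← h', mul_comm]
  choose d hd0 a ha using hden
  refine ⟨∏ x ∈ s, d x, Finset.prod_ne_zero_iff.mpr fun x _ => hd0 x, ?_⟩
  intro b hb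
  induction hb using Algebra.adjoin_induction with
  | mem x hx =>
    refine ⟨1, a x * ∏ y ∈ s.erase x, d y, ?_⟩
    rw [pow_one, ← Finset.mul_prod_erase s d hx]
    push_cast
    rw [ha x]
    ring
  | algebraMap r =>
    refine ⟨0, r, ?_⟩
    rw [pow_zero, one_mul]
    rfl
  | add x y _ _ hx hy =>
    obtain ⟨n₁, a₁, h₁⟩ := hx
    obtain ⟨n₂, a₂, h₂⟩ := hy
    refine ⟨n₁ + n₂, (∏ x ∈ s, d x) ^ n₂ * a₁ + (∏ x ∈ s, d x) ^ n₁ * a₂, ?_⟩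
    push_cast
    rw [h₁, h₂]
    push_cast
    ring
  | mul x y _ _ hx hy =>
    obtain ⟨n₁, a₁, h₁⟩ := hx
    obtain ⟨n₂, a₂, h₂⟩ := hy
    refine ⟨n₁ + n₂, a₁ * a₂, ?_⟩
    push_cast
    rw [h₁, h₂]
    push_cast
    ring

/-- **G0a. The singular sandwiched stage has a RATIONAL singularity** (modulo Lipman (1.2)): for
`ctx : SandwichCtx O A R m₀`, `m ≥ m₀ + 1` and `T_m` singular, `HasRationalSingularity T_m`. Proof: the
regular base `R ≤ T_m` has a rational singularity; `T_m`, essentially of finite type over `k ⊆ R`, is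
the localisation at a prime of a finitely generated `R`-subalgebra `B₀ ⊆ T_m ⊆ K = Frac R` (with a
common denominator), i.e. a normal two-dimensional local ring of the birational affine model
`Spec B₀ → Spec R`; Lipman's Prop. (1.2) (1) applies. [cite: Lipman1969, Proposition (1.2) 1) (p. 199)] -/
theorem hasRationalSingularity_tower (h12 : Lipman1969_1_2.{0}) (O : ValuationSubring K)
    (A R : Subalgebra k K) (m₀ : ℕ) (ctx : SandwichCtx O A R m₀) (m : ℕ) (hm : m₀ + 1 ≤ m)
    (hsing : ¬ IsRegularLocalRing ↥(tower O A m)) : HasRationalSingularity ↥(tower O A m) := by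
  obtain ⟨hk, hA, hfr, hAO, -, hRreg, hRfr, -, -, hRT⟩ := id ctx
  obtain ⟨_, _, _, _, hdimT, -, hdimR⟩ := stage_package O A R m₀ ctx m hm hsing
  haveI := hRreg
  haveI := hRfr
  set T : Subalgebra k K := tower O A m with hTdef
  have hRT' : R ≤ T := hRT m (by omega)
  haveI : IsIntegrallyClosed ↥R := isIntegrallyClosed_of_isRegularLocalRing _
  -- `T` as an `R`-algebra, essentially of finite type
  letI : Algebra ↥R ↥T := (Subalgebra.inclusion hRT').toRingHom.toAlgebra
  haveI : IsScalarTower k ↥R ↥T := IsScalarTower.of_algebraMap_eq fun c => rfl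
  haveI : Algebra.EssFiniteType k ↥T := (tn_tower_invariant O A hk hA hfr hAO m).2.2
  haveI : Algebra.EssFiniteType ↥R ↥T := Algebra.EssFiniteType.of_comp k ↥R ↥T
  -- the finitely generated model `B₀` and the prime `𝔮 = 𝔪_T ∩ B₀`
  set B₀ : Subalgebra ↥R ↥T := Algebra.EssFiniteType.subalgebra ↥R ↥T with hB₀
  let 𝔮 : Ideal ↥B₀ := (maximalIdeal ↥T).comap (algebraMap ↥B₀ ↥T)
  haveI : 𝔮.IsPrime := Ideal.comap_isPrime _ _
  have hsub : Algebra.EssFiniteType.submonoid ↥R ↥T = 𝔮.primeCompl := by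
    ext x
    simp only [Algebra.EssFiniteType.submonoid, Submonoid.mem_comap, IsUnit.mem_submonoid_iff,
      Ideal.primeCompl, 𝔮]
    change _ ↔ algebraMap (↥B₀) (↥T) x ∉ maximalIdeal ↥T
    rw [IsLocalRing.mem_maximalIdeal, mem_nonunits_iff, not_not]
  haveI : IsLocalization.AtPrime ↥T 𝔮 := by
    rw [IsLocalization.AtPrime, ← hsub]; infer_instance
  -- injectivity of `R → B₀` and the common denominator
  have hcoe : ∀ a : ↥R, (((algebraMap ↥R ↥B₀ a : ↥B₀) : ↥T) : K) = (a : K) := fun a => rfl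
  have hinj : Function.Injective (algebraMap ↥R ↥B₀) := by
    intro a b h
    have := congrArg (fun x : ↥B₀ => ((x : ↥T) : K)) h
    simp only [hcoe] at this
    exact Subtype.ext this
  obtain ⟨r, hr0, hden⟩ := exists_denominator_adjoin R T hRT' (Algebra.EssFiniteType.finset ↥R ↥T)
  have hB : ∀ b : ↥B₀, ∃ n : ℕ, ∃ a : ↥R,
      algebraMap ↥R ↥B₀ a = algebraMap ↥R ↥B₀ r ^ n * b := by
    intro b
    obtain ⟨n, a, h⟩ := hden b b.2
    refine ⟨n, a, Subtype.ext (Subtype.ext ?_)⟩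
    rw [hcoe]
    push_cast
    rw [h]
    rfl
  exact hasRationalSingularity_of_isLocalization h12 hdimR (hasRationalSingularity_of_isRegularLocalRing ↥R)
    hinj r hr0 hB 𝔮 (T := ↥T) hdimT

/-- **G0b for the stage** (modulo Lipman (1.2)): every resolution `π : X ⟶ Spec T_m` of the singular
late stage has `H¹(X, 𝒪_X) = 0` — the rationality binder of the G-layer (Lemma A (A5), Lemma B,
Lipman (12.1)), for ANY resolution, in particular any minimal one.
[cite: Lipman1969, Proposition (1.2) 2) (p. 199)] -/
theorem hasTrivialCechH1_of_isResolution_tower (h12 : Lipman1969_1_2.{0}) (O : ValuationSubring K)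
    (A R : Subalgebra k K) (m₀ : ℕ) (ctx : SandwichCtx O A R m₀) (m : ℕ) (hm : m₀ + 1 ≤ m)
    (hsing : ¬ IsRegularLocalRing ↥(tower O A m)) {X : Scheme.{0}}
    (π : X ⟶ Spec (.of ↥(tower O A m))) (hπ : IsResolution π) : HasTrivialCechH1 π := by
  obtain ⟨_, _, _, _, hdimT, -, -⟩ := stage_package O A R m₀ ctx m hm hsing
  exact h12.hasTrivialCechH1_of_isResolution hdimT
    (hasRationalSingularity_tower h12 O A R m₀ ctx m hm hsing) π hπ

/-- **GE = registered stub `stub_minResolutionExists`, CONDITIONAL form** (modulo Lipman (1.2) and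
(4.1)): the singular late stage `T_m` has a minimal resolution `π : X ⟶ Spec T_m`. The registered
signature (skeleton v15) is this statement without the two named-fact binders.
[cite: Lipman1969, Theorem (4.1) (p. 204)] -/
theorem minResolutionExists_of_lipman (h12 : Lipman1969_1_2.{0}) (h41 : Lipman1969_4_1.{0})
    (p : ℕ) (_hp : p.Prime) (k K : Type) [Field k] [CharP k p] [Field K] [Algebra k K]
    (O : ValuationSubring K) (A R : Subalgebra k K) (m₀ : ℕ) (ctx : SandwichCtx O A R m₀) (m : ℕ)
    (hm : m₀ + 1 ≤ m) (hsing : ¬ IsRegularLocalRing ↥(tower O A m)) :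
    ∃ (X : AlgebraicGeometry.Scheme.{0}) (π : X ⟶ AlgebraicGeometry.Spec (CommRingCat.of ↥(tower O A m))),
      Literature.AlgebraicGeometry.Resolution.IsMinimalResolution π := by
  obtain ⟨_, _, _, _, hdimT, -, -⟩ := stage_package O A R m₀ ctx m hm hsing
  exact h41.exists_isMinimalResolution_Spec ↥(tower O A m) hdimT
    (hasRationalSingularity_tower h12 O A R m₀ ctx m hm hsing)

end Tower

end Summit.ResolutionOfSingularities.ResolutionOfSingularities.Theorems.NoZeno.SandwichCluster

end
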